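import Literature.Analysis.FluidPDE.PassiveScalarReleasePairing
import Literature.Analysis.FluidPDE.SourcedScalarBudget
import HarnessLib

/-!
# Grid age decoupling, I: the trace of a release tested against a steady smooth profile

Analysis/FluidPDE proof-support file (everything proved). Deterministic per-release facts used by
the GRID form of the age-decoupling argument (`FluidPDE/AgeDecouplingInequality`,
`FluidPDE/AgeDecouplingGridSums`): for a weak solution `R` of the homogeneous equation
`∂ₜR + w·∇R = κΔR` on `[0, T_b)` (a RELEASE of its datum `a₀`) tested against a smooth steady
profile `h`,

* the flux `r ↦ ∫ R(r) (⟪w(r), ∇h⟫ + κΔh)` has the a.e. size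
  `C_∇ (‖R‖² + ‖w‖²)/2 + κ C_Δ (1 + ‖R‖²)/2` (`ae_abs_releaseFlux_le`) and is integrable on `(0, T_b]`;
* the absolutely continuous trace `P_R(t) = ∫ a₀ h + ∫_{(0,t]} ∫ R (⟪w, ∇h⟫ + κΔh)` of
  `t ↦ ∫ R(t) h` is continuous on `[0, T_b]` (`continuousOn_releaseTrace`), has modulus
  `|P_R(t₂) - P_R(t₁)| ≤ ∫_{t₁}^{t₂} k` for every integrable a.e. majorant `k` of the flux
  (`abs_releaseTrace_sub_le_of_ae_le`), and `∫_{(0,τ]} ∫ R(τ') h dτ' = ∫₀^τ P_R`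
  (`setIntegral_pairing_eq_integral_releaseTrace`).

These feed the right Riemann sums of `AgeDecouplingGridSums.sum_sub_le_integral`.

## References

* R. J. DiPerna, P.-L. Lions, Invent. Math. 98 (1989), §II.1 (13)–(14). [`DiPernaLions1989`]
* T. D. Drivas, T. M. Elgindi, G. Iyer, I.-J. Jeong, ARMA 243 (2022), (1.1)–(1.3). [`DEIJ2022`]
-/

noncomputable section

open _root_.MeasureTheory _root_.Set _root_.Filter _root_.Function _root_.TopologicalSpace
open scoped ENNReal NNReal InnerProductSpace

namespace Literature.Analysis.FluidPDE

namespace Torus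

variable {d : Type*} [Fintype d]

namespace IsWeakScalarTransportOn

variable {Tb κ : ℝ} {w : ℝ → UnitAddTorus d → EuclideanSpace ℝ d} {a₀ h : UnitAddTorus d → ℝ}
  {R : ℝ → UnitAddTorus d → ℝ}

/-! ## The flux of a release tested against a steady smooth profile -/

/-- **Size of the flux of a release**: for `κ ≥ 0` and a.e. `r ∈ (0, T_b)`,
`|∫ R(r)(⟪w(r), ∇h⟫ + κΔh)| ≤ C_∇ (‖R(r)‖² + ‖w(r)‖²)/2 + κ C_Δ (1 + ‖R(r)‖²)/2`
(`|R||w| ≤ (R² + |w|²)/2`, `|R| ≤ (1 + R²)/2`). [folklore] -/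
theorem ae_abs_releaseFlux_le (hκ : 0 ≤ κ) (hR : IsWeakScalarTransportOn Tb κ w a₀ R)
    {Cg Cl : ℝ} (hCg : ∀ x, ‖FunctionSpaces.Torus.gradient h x‖ ≤ Cg)
    (hCl : ∀ x, |FunctionSpaces.Torus.laplacian h x| ≤ Cl) :
    ∀ᵐ r ∂((volume : Measure ℝ).restrict (Ioo 0 Tb)),
      |∫ y, R r y * (⟪w r y, FunctionSpaces.Torus.gradient h y⟫_ℝ + κ * FunctionSpaces.Torus.laplacian h y)| ≤
        Cg * (scalarL2Sq (R r) + ∫ y, ‖w r y‖ ^ 2) / 2 + κ * Cl * (1 + scalarL2Sq (R r)) / 2 := by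
  -- adapted from Literature/Analysis/FluidPDE/SourcedScalarBudget.lean (`ae_abs_traceDeriv_le`)
  have hCg0 : 0 ≤ Cg := (norm_nonneg _).trans (hCg 0)
  have hCl0 : 0 ≤ Cl := (abs_nonneg _).trans (hCl 0)
  filter_upwards [hR.ae_memLp_two, hR.ae_slice_integrable₁, hR.ae_memLp_two_velocity] with r hm2 hsl hvL2
  obtain ⟨hθi, -, hvθ⟩ := hsl
  have hv2 : Integrable (fun y => ‖w r y‖ ^ 2) volume := (memLp_two_iff_integrable_sq_norm hvL2.1).1 hvL2
  have hθ2 : Integrable (fun y => R r y ^ 2) volume := hm2.integrable_sq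
  have hav' : Integrable (fun y => ‖w r y‖ * |R r y|) volume := by
    refine hvθ.norm.congr (Eventually.of_forall fun y => ?_); simp [Real.norm_eq_abs]
  have hpt : ∀ y, |R r y * (⟪w r y, FunctionSpaces.Torus.gradient h y⟫_ℝ + κ * FunctionSpaces.Torus.laplacian h y)| ≤
      Cg * (‖w r y‖ * |R r y|) + κ * Cl * |R r y| := by
    intro y
    rw [abs_mul]
    have h1 : |⟪w r y, FunctionSpaces.Torus.gradient h y⟫_ℝ| ≤ ‖w r y‖ * Cg :=
      (abs_real_inner_le_norm _ _).trans (mul_le_mul_of_nonneg_left (hCg y) (norm_nonneg _))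
    have h2 : |κ * FunctionSpaces.Torus.laplacian h y| ≤ κ * Cl := by
      rw [abs_mul, abs_of_nonneg hκ]; exact mul_le_mul_of_nonneg_left (hCl y) hκ
    calc |R r y| * |⟪w r y, FunctionSpaces.Torus.gradient h y⟫_ℝ + κ * FunctionSpaces.Torus.laplacian h y|
        ≤ |R r y| * (‖w r y‖ * Cg + κ * Cl) :=
          mul_le_mul_of_nonneg_left ((abs_add_le _ _).trans (add_le_add h1 h2)) (abs_nonneg _)
      _ = Cg * (‖w r y‖ * |R r y|) + κ * Cl * |R r y| := by ring
  have i1 : ∫ y, ‖w r y‖ * |R r y| ≤ (scalarL2Sq (R r) + ∫ y, ‖w r y‖ ^ 2) / 2 := by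
    have h3 : ∫ y, ‖w r y‖ * |R r y| ≤ ∫ y, (R r y ^ 2 + ‖w r y‖ ^ 2) / 2 :=
      integral_mono hav' ((hθ2.add hv2).div_const 2) fun y => by
        dsimp only; nlinarith [sq_nonneg (‖w r y‖ - |R r y|), sq_abs (R r y)]
    rw [integral_div, integral_add hθ2 hv2] at h3
    rw [scalarL2Sq]; linarith
  have i2 : ∫ y, |R r y| ≤ (1 + scalarL2Sq (R r)) / 2 := by
    have h3 : ∫ y, |R r y| ≤ ∫ y, (1 + R r y ^ 2) / 2 :=
      integral_mono hθi.abs (((integrable_const (1 : ℝ)).add hθ2).div_const 2) fun y => by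
        dsimp only; nlinarith [sq_nonneg (|R r y| - 1), sq_abs (R r y)]
    rw [integral_div, integral_add (integrable_const _) hθ2, integral_const] at h3
    simp only [probReal_univ, smul_eq_mul, one_mul] at h3
    rw [scalarL2Sq]; linarith
  calc |∫ y, R r y * (⟪w r y, FunctionSpaces.Torus.gradient h y⟫_ℝ + κ * FunctionSpaces.Torus.laplacian h y)|
      ≤ ∫ y, |R r y * (⟪w r y, FunctionSpaces.Torus.gradient h y⟫_ℝ + κ * FunctionSpaces.Torus.laplacian h y)| :=
        abs_integral_le_integral_abs
    _ ≤ ∫ y, (Cg * (‖w r y‖ * |R r y|) + κ * Cl * |R r y|) :=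
        integral_mono_of_nonneg (Eventually.of_forall fun y => abs_nonneg _)
          ((hav'.const_mul Cg).add (hθi.abs.const_mul _)) (Eventually.of_forall hpt)
    _ = Cg * (∫ y, ‖w r y‖ * |R r y|) + κ * Cl * (∫ y, |R r y|) := by
        rw [integral_add (hav'.const_mul Cg) (hθi.abs.const_mul _), MeasureTheory.integral_const_mul,
          MeasureTheory.integral_const_mul]
    _ ≤ Cg * ((scalarL2Sq (R r) + ∫ y, ‖w r y‖ ^ 2) / 2) + κ * Cl * ((1 + scalarL2Sq (R r)) / 2) :=
        add_le_add (mul_le_mul_of_nonneg_left i1 hCg0) (mul_le_mul_of_nonneg_left i2 (mul_nonneg hκ hCl0))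
    _ = Cg * (scalarL2Sq (R r) + ∫ y, ‖w r y‖ ^ 2) / 2 + κ * Cl * (1 + scalarL2Sq (R r)) / 2 := by ring

/-! ## The trace of a release tested against a steady smooth profile -/

/-- The flux `r ↦ ∫ R(r)(⟪w(r), ∇h⟫ + κΔh)` of a release is integrable on `(0, T_b]`. [folklore] -/
theorem integrableOn_releaseFlux (hR : IsWeakScalarTransportOn Tb κ w a₀ R) (hh : FunctionSpaces.Torus.IsSmooth h) :
    IntegrableOn (fun r => ∫ y, R r y *
      (⟪w r y, FunctionSpaces.Torus.gradient h y⟫_ℝ + κ * FunctionSpaces.Torus.laplacian h y)) (Ioc 0 Tb) volume := by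
  have h0 : IntegrableOn (fun r => ∫ y, R r y *
      (⟪w r y, FunctionSpaces.Torus.gradient h y⟫_ℝ + κ * FunctionSpaces.Torus.laplacian h y)) (Ioo 0 Tb) volume :=
    (hR.integrable_mul_steadyFlux hh).integral_prod_left
  exact h0.congr_set_ae Ioo_ae_eq_Ioc.symm

/-- **The trace of a release is continuous on `[0, T_b]`.** [folklore] -/
theorem continuousOn_releaseTrace (hR : IsWeakScalarTransportOn Tb κ w a₀ R) (hh : FunctionSpaces.Torus.IsSmooth h) :
    ContinuousOn (fun t => (∫ y, a₀ y * h y) + ∫ r in Ioc 0 t, ∫ y, R r y *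
      (⟪w r y, FunctionSpaces.Torus.gradient h y⟫_ℝ + κ * FunctionSpaces.Torus.laplacian h y)) (Icc 0 Tb) := by
  -- adapted from Literature/Analysis/FluidPDE/SourcedScalarBudget.lean (`continuousOn_trace`)
  have hi : IntegrableOn (fun r => ∫ y, R r y *
      (⟪w r y, FunctionSpaces.Torus.gradient h y⟫_ℝ + κ * FunctionSpaces.Torus.laplacian h y)) (Icc 0 Tb) volume :=
    (integrableOn_releaseFlux hR hh).congr_set_ae Ioc_ae_eq_Icc.symm
  exact continuousOn_const.add (intervalIntegral.continuousOn_primitive hi)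

/-- **Modulus of the trace of a release against an integrable a.e. majorant of the flux**: if
`|∫ R(r)(⟪w, ∇h⟫ + κΔh)| ≤ k(r)` for a.e. `r ∈ (0, T_b)` with `k` integrable on `(0, T_b]`, then for
`0 ≤ t₁ ≤ t₂ ≤ T_b`, `|P_R(t₂) - P_R(t₁)| ≤ ∫_{t₁}^{t₂} k`. [folklore] -/
theorem abs_releaseTrace_sub_le_of_ae_le (hR : IsWeakScalarTransportOn Tb κ w a₀ R)
    (hh : FunctionSpaces.Torus.IsSmooth h) {k : ℝ → ℝ} (hk : IntegrableOn k (Ioc 0 Tb) volume)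
    (hle : ∀ᵐ r ∂((volume : Measure ℝ).restrict (Ioo 0 Tb)),
      |∫ y, R r y * (⟪w r y, FunctionSpaces.Torus.gradient h y⟫_ℝ + κ * FunctionSpaces.Torus.laplacian h y)| ≤ k r)
    {t₁ t₂ : ℝ} (ht₁ : 0 ≤ t₁) (ht : t₁ ≤ t₂) (ht₂ : t₂ ≤ Tb) :
    |((∫ y, a₀ y * h y) + ∫ r in Ioc 0 t₂, ∫ y, R r y *
        (⟪w r y, FunctionSpaces.Torus.gradient h y⟫_ℝ + κ * FunctionSpaces.Torus.laplacian h y)) -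
      ((∫ y, a₀ y * h y) + ∫ r in Ioc 0 t₁, ∫ y, R r y *
        (⟪w r y, FunctionSpaces.Torus.gradient h y⟫_ℝ + κ * FunctionSpaces.Torus.laplacian h y))| ≤
      ∫ r in t₁..t₂, k r := by
  set F : ℝ → ℝ := fun r => ∫ y, R r y *
    (⟪w r y, FunctionSpaces.Torus.gradient h y⟫_ℝ + κ * FunctionSpaces.Torus.laplacian h y) with hF
  have hFi : IntegrableOn F (Ioc 0 Tb) volume := integrableOn_releaseFlux hR hh
  have h1 : IntervalIntegrable F volume 0 t₁ :=
    (intervalIntegrable_iff_integrableOn_Ioc_of_le ht₁).2 (hFi.mono_set (Ioc_subset_Ioc_right (ht.trans ht₂)))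
  have h2 : IntervalIntegrable F volume t₁ t₂ :=
    (intervalIntegrable_iff_integrableOn_Ioc_of_le ht).2 (hFi.mono_set (Ioc_subset_Ioc ht₁ ht₂))
  have hk2 : IntervalIntegrable k volume t₁ t₂ :=
    (intervalIntegrable_iff_integrableOn_Ioc_of_le ht).2 (hk.mono_set (Ioc_subset_Ioc ht₁ ht₂))
  have e : ((∫ y, a₀ y * h y) + ∫ r in Ioc 0 t₂, F r) - ((∫ y, a₀ y * h y) + ∫ r in Ioc 0 t₁, F r) = ∫ r in t₁..t₂, F r := by
    rw [← intervalIntegral.integral_of_le (ht₁.trans ht), ← intervalIntegral.integral_of_le ht₁,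
      ← intervalIntegral.integral_add_adjacent_intervals h1 h2]
    ring
  rw [e]
  refine (intervalIntegral.abs_integral_le_integral_abs ht).trans ?_
  refine intervalIntegral.integral_mono_ae_restrict ht h2.abs hk2 ?_
  have hsub : Icc t₁ t₂ ⊆ Icc 0 Tb := Icc_subset_Icc ht₁ ht₂
  have hle' : ∀ᵐ r ∂((volume : Measure ℝ).restrict (Icc 0 Tb)), |F r| ≤ k r := by
    rw [← Measure.restrict_congr_set (Ioo_ae_eq_Icc (a := (0 : ℝ)) (b := Tb))]; exact hle
  exact ae_restrict_of_ae_restrict_of_subset hsub hle'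

/-- **The trace is the pairing, integrated**: `∫_{(0,τ]} ∫ R(τ') h dτ' = ∫₀^τ P_R` for `0 ≤ τ ≤ T_b`
(the pairing `∫ R(τ') h` equals its trace for a.e. `τ'`). [cite: DiPernaLions1989, §II.1 (14)] -/
theorem setIntegral_pairing_eq_integral_releaseTrace (hR : IsWeakScalarTransportOn Tb κ w a₀ R)
    (hh : FunctionSpaces.Torus.IsSmooth h) {τ : ℝ} (hτ0 : 0 ≤ τ) (hτ : τ ≤ Tb) :
    ∫ τ' in Ioc 0 τ, ∫ y, R τ' y * h y = ∫ t in (0 : ℝ)..τ, ((∫ y, a₀ y * h y) + ∫ r in Ioc 0 t, ∫ y, R r y *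
      (⟪w r y, FunctionSpaces.Torus.gradient h y⟫_ℝ + κ * FunctionSpaces.Torus.laplacian h y)) := by
  rw [intervalIntegral.integral_of_le hτ0]
  refine integral_congr_ae ?_
  have h1 := hR.ae_integral_mul_eq hh
  have h2 : ∀ᵐ t ∂((volume : Measure ℝ).restrict (Icc 0 Tb)), ∫ y, R t y * h y = (∫ y, a₀ y * h y) +
      ∫ r in Ioc 0 t, ∫ y, R r y * (⟪w r y, FunctionSpaces.Torus.gradient h y⟫_ℝ + κ * FunctionSpaces.Torus.laplacian h y) := by
    rw [← Measure.restrict_congr_set (Ioo_ae_eq_Icc (a := (0 : ℝ)) (b := Tb))]; exact h1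
  exact ae_restrict_of_ae_restrict_of_subset (show Ioc 0 τ ⊆ Icc 0 Tb from fun r hr => ⟨hr.1.le, hr.2.trans hτ⟩) h2

end IsWeakScalarTransportOn

end Torus

end Literature.Analysis.FluidPDE
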